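import Mathlib.Analysis.MeanInequalitiesPow
import Mathlib.Analysis.SpecialFunctions.Pow.Deriv
import Literature.Analysis.Complex.HalfPlaneDistortion
import HarnessLib

/-!
# Hölder continuity from the derivative growth `|F'(z)| ≤ C (im z)^{h-1}` (Rohde–Schramm Thm. 5.2, steps 2–3)

Trunk T-STOCH support (deterministic complex analysis in `ℍₒ`). The two deterministic steps that
conclude the proof of Rohde–Schramm's **Theorem 5.2** (Hölder continuity of `f̂ₜ`; *Basic
properties of SLE*, Ann. Math. 161 (2005) = arXiv:math/0106036, Thm. 11, p. 12), read verbatim: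

> "From the Koebe distortion Theorem and (5.2) [`|f̂ₜ'(z_{j,n})| ≤ C(ω,t) 2^{n(1-h)}` on the grid
> `z_{j,n} = (j + i) 2^{-n}`] we obtain `|f̂ₜ'(z)| ≤ O(1) C(ω, t) y^{h-1}` for all `z ∈ A`. It is
> well-known and easy to see, by integrating `|f'|` over the hyperbolic geodesic from `z` to `z'`
> (similarly to the end of the proof of Theorem 3.6), that this implies Hölder continuity with
> exponent `h` on `A`. The theorem follows."

For a map `F` holomorphic and injective on `ℍₒ` we prove:

* `RohdeSchramm.norm_deriv_le_rpow_of_boxGrid` — **grid to box by Koebe distortion**: if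
  `|F'((j + i) 2^{-n})| ≤ C 2^{(1-h) n}` for all `n ∈ ℕ`, `|j| ≤ R 2ⁿ` (`h ≤ 1`), then
  `|F'(w)| ≤ 12⁶ C (im w)^{h-1}` whenever `0 < im w ≤ 1`, `|re w| ≤ R` (the nearest grid point at
  the dyadic scale of `im w` is `≤ 6` half-plane Koebe steps away,
  `Literature.Analysis.Complex.AreaThm.norm_deriv_le_pow_mul`).
* `RohdeSchramm.norm_sub_le_of_vertical`, `RohdeSchramm.norm_sub_le_of_horizontal` — integrating
  `|F'|` along vertical segments (`≤ C (Y^h - y^h)/h`, Mathlib's ODE-comparison form of the mean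
  value inequality `image_norm_le_of_norm_deriv_right_le_deriv_boundary'`) and along horizontal
  ones (`≤ C Y^{h-1} · length`).
* `RohdeSchramm.norm_sub_le_rpow_of_norm_deriv_le` — **derivative growth to Hölder continuity**:
  if `|F'(w)| ≤ C (im w)^{h-1}` on `{0 < im w ≤ 1, |re w| ≤ R}` (`0 < h ≤ 1`), then
  `|F z - F z'| ≤ (40 C (R + 1)/h) |z - z'|^h` on the box `{0 < im ≤ 1/2, |re| ≤ R}` — for close
  pairs via the path `z ↑ (re z + iY) → (re z' + iY) ↓ z'` at height `Y = max(im z, im z', 2|z-z'|)`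
  (the elementary substitute for the hyperbolic geodesic; subadditivity `Y^h - y^h ≤ (Y - y)^h`),
  for far pairs via the bound `|F z - F(i/2)| ≤ C/h + 2CR` obtained the same way.

## References

* S. Rohde, O. Schramm, *Basic properties of SLE*, Ann. of Math. 161 (2005), Thm. 5.2 and its
  proof (arXiv:math/0106036, Thm. 11, p. 12).
* Ch. Pommerenke, *Boundary Behaviour of Conformal Maps* (1992), Thm. 1.3 (Koebe distortion).
* P. L. Duren, *Theory of Hᵖ spaces* (1970), Thm. 5.1 (Hardy–Littlewood: `|f'| ≤ C(1-r)^{h-1}`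
  iff `f ∈ Lip h`), for the classical disc form of the last step.
-/

noncomputable section

open Set Filter Topology Metric Complex
open UpperHalfPlane (upperHalfPlaneSet isOpen_upperHalfPlaneSet)
open Literature.Analysis.Complex

namespace Literature.Probability.RandomPlanarGeometry

namespace RohdeSchramm

variable {F : ℂ → ℂ}

/-! ### From the grid to the box: Koebe distortion -/

/-- **Grid to box** ("From the Koebe distortion Theorem and (5.2) we obtain
`|f̂ₜ'(z)| ≤ O(1) C(ω,t) y^{h-1}` for all `z ∈ A`"): for `F` holomorphic and injective on `ℍₒ`
with `|F'((j + i) 2^{-n})| ≤ C 2^{(1-h) n}` for all `n ∈ ℕ` and integers `|j| ≤ R 2ⁿ` (`h ≤ 1`,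
`C ≥ 0`), every `w` with `0 < im w ≤ 1` and `|re w| ≤ R` has `|F'(w)| ≤ 12⁶ C (im w)^{h-1}`: with
`2ⁿ ≤ 1/im w < 2ⁿ⁺¹` and `j = ⌊2ⁿ re w⌋` the grid point `z = (j + i) 2^{-n}` satisfies
`|w - z| ≤ (3/2) 2^{-n}` with `im z, im w ≥ 2^{-n-1}`, i.e. `6` chained Koebe steps
(`AreaThm.norm_deriv_le_pow_mul`), and `2^{(1-h)n} = (2^{-n})^{h-1} ≤ (im w)^{h-1}`.
[cite: RohdeSchramm2005, Thm 5.2 (proof, arXiv p. 12)] -/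
theorem norm_deriv_le_rpow_of_boxGrid (hF : DifferentiableOn ℂ F upperHalfPlaneSet)
    (hinj : InjOn F upperHalfPlaneSet) {h C : ℝ} (hh1 : h ≤ 1) (hC : 0 ≤ C) {R : ℕ}
    (hgrid : ∀ (n : ℕ) (j : ℤ), |j| ≤ (R : ℤ) * 2 ^ n →
      ‖deriv F ((((j : ℝ) * (2 : ℝ) ^ (-(n : ℝ)) : ℝ) : ℂ) +
        I * (((2 : ℝ) ^ (-(n : ℝ)) : ℝ) : ℂ))‖ ≤ C * (2 : ℝ) ^ ((1 - h) * n))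
    {w : ℂ} (hw0 : 0 < w.im) (hw1 : w.im ≤ 1) (hwR : |w.re| ≤ R) :
    ‖deriv F w‖ ≤ 12 ^ 6 * C * w.im ^ (h - 1) := by
  -- the dyadic scale of `im w`
  obtain ⟨n, hn1, hn2⟩ := exists_nat_pow_near (one_le_inv_iff₀.2 ⟨hw0, hw1⟩) one_lt_two
  set q : ℝ := ((2 : ℝ) ^ n)⁻¹ with hq
  have hq0 : 0 < q := by positivity
  have hrpow : (2 : ℝ) ^ (-(n : ℝ)) = q := by
    rw [Real.rpow_neg two_pos.le, Real.rpow_natCast]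
  have hwq : w.im ≤ q := by
    rw [hq, le_inv_comm₀ hw0 (by positivity)]
    exact hn1
  have hqw : q / 2 < w.im := by
    have h1 : ((2 : ℝ) ^ (n + 1))⁻¹ < w.im := inv_lt_of_inv_lt₀ hw0 hn2
    have h2 : q / 2 = ((2 : ℝ) ^ (n + 1))⁻¹ := by rw [hq, pow_succ, mul_inv, div_eq_mul_inv]
    rwa [h2]
  -- the nearest grid point `z = (j + i) q`, `j = ⌊re w / q⌋`
  set j : ℤ := ⌊w.re * 2 ^ n⌋ with hj
  have hjR : |j| ≤ (R : ℤ) * 2 ^ n := by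
    have h1 : |w.re * 2 ^ n| ≤ (R : ℝ) * 2 ^ n := by
      rw [abs_mul, abs_of_pos (by positivity : (0 : ℝ) < 2 ^ n)]
      exact mul_le_mul_of_nonneg_right hwR (by positivity)
    obtain ⟨h1l, h1r⟩ := abs_le.1 h1
    rw [abs_le]
    constructor
    · rw [hj, Int.le_floor]
      push_cast
      exact h1l
    · rw [hj, ← Int.floor_intCast (R := ℝ) ((R : ℤ) * 2 ^ n)]
      apply Int.floor_le_floor
      push_cast
      exact h1r
  set z : ℂ := ((((j : ℝ) * (2 : ℝ) ^ (-(n : ℝ)) : ℝ) : ℂ) + I * (((2 : ℝ) ^ (-(n : ℝ)) : ℝ) : ℂ))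
    with hz
  have hz_im : z.im = q := by rw [hz, hrpow]; simp
  have hz_re : z.re = j * q := by rw [hz, hrpow]; simp
  have hgz : ‖deriv F z‖ ≤ C * (2 : ℝ) ^ ((1 - h) * n) := hgrid n j hjR
  -- `|w - z| ≤ (3/2) q`
  have hdist : ‖w - z‖ ≤ 6 * (q / 2) / 2 := by
    have h1 : |(w - z).re| ≤ q := by
      rw [sub_re, hz_re]
      have hf1 := Int.floor_le (w.re * 2 ^ n)
      have hf2 := Int.lt_floor_add_one (w.re * 2 ^ n)
      rw [← hj] at hf1 hf2
      have hq2 : (2 : ℝ) ^ n * q = 1 := by rw [hq]; field_simp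
      have e : w.re - j * q = (w.re * 2 ^ n - j) * q := by
        rw [sub_mul, mul_assoc, hq2, mul_one]
      rw [e, abs_le]
      constructor
      · nlinarith [mul_nonneg (sub_nonneg.2 hf1) hq0.le]
      · have h3 : (w.re * 2 ^ n - j) * q ≤ 1 * q :=
          mul_le_mul_of_nonneg_right (by linarith) hq0.le
        linarith
    have h2 : |(w - z).im| ≤ q / 2 := by
      rw [sub_im, hz_im, abs_le]
      constructor <;> linarith
    have := norm_le_abs_re_add_abs_im (w - z)
    linarith
  have hchain := AreaThm.norm_deriv_le_pow_mul hF hinj (half_pos hq0) 6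
    (z := z) (w := w) (by rw [hz_im]; linarith) hqw.le (by push_cast; linarith)
  -- `2^{(1-h) n} = q^{h-1} ≤ (im w)^{h-1}`
  have hexp : (2 : ℝ) ^ ((1 - h) * n) = q ^ (h - 1) := by
    rw [← hrpow, ← Real.rpow_mul two_pos.le]
    congr 1
    ring
  have hmono : q ^ (h - 1) ≤ w.im ^ (h - 1) :=
    Real.rpow_le_rpow_of_nonpos hw0 hwq (by linarith)
  calc ‖deriv F w‖ ≤ 12 ^ 6 * ‖deriv F z‖ := hchain
    _ ≤ 12 ^ 6 * (C * q ^ (h - 1)) := by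
        rw [← hexp]
        exact mul_le_mul_of_nonneg_left hgz (by positivity)
    _ ≤ 12 ^ 6 * (C * w.im ^ (h - 1)) :=
        mul_le_mul_of_nonneg_left (mul_le_mul_of_nonneg_left hmono hC) (by positivity)
    _ = 12 ^ 6 * C * w.im ^ (h - 1) := by ring

/-! ### Integrating `|F'|` along vertical and horizontal segments -/

/-- **Vertical segments**: if `F` is complex differentiable at the points `x + is`, `s ∈ [y, Y]`
(`0 < y ≤ Y`), with `|F'(x + is)| ≤ C s^{h-1}` there (`h > 0`), then
`|F(x + iY) - F(x + iy)| ≤ C (Y^h - y^h)/h` (comparison with the solution `B(s) = C (s^h - y^h)/h`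
of `B' = C s^{h-1}`, Mathlib `image_norm_le_of_norm_deriv_right_le_deriv_boundary'`).
[cite: RohdeSchramm2005, Thm 5.2 (proof, arXiv p. 12)] -/
theorem norm_sub_le_of_vertical {x y Y C h : ℝ} (hh0 : 0 < h) (hy : 0 < y) (hyY : y ≤ Y)
    (hdiff : ∀ s ∈ Icc y Y, DifferentiableAt ℂ F ((x : ℂ) + (s : ℂ) * I))
    (hder : ∀ s ∈ Icc y Y, ‖deriv F ((x : ℂ) + (s : ℂ) * I)‖ ≤ C * s ^ (h - 1)) :
    ‖F ((x : ℂ) + (Y : ℂ) * I) - F ((x : ℂ) + (y : ℂ) * I)‖ ≤ C * (Y ^ h - y ^ h) / h := by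
  -- the path `γ s = x + is` and `g = F ∘ γ - F(γ y)`
  set γ : ℝ → ℂ := fun s ↦ (x : ℂ) + (s : ℂ) * I with hγ
  have hγd : ∀ s, HasDerivAt γ I s := fun s ↦ by
    have h1 : HasDerivAt (fun s : ℝ ↦ (s : ℂ) * I) (1 * I) s :=
      (Complex.ofRealCLM.hasDerivAt).mul_const I
    rw [one_mul] at h1
    exact h1.const_add _
  set g : ℝ → ℂ := fun s ↦ F (γ s) - F (γ y) with hg
  have hgd : ∀ s ∈ Icc y Y, HasDerivAt g (I • deriv F (γ s)) s := fun s hs ↦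
    ((hdiff s hs).hasDerivAt.scomp s (hγd s)).sub_const _
  set B : ℝ → ℝ := fun s ↦ C * (s ^ h - y ^ h) / h with hB
  have hBd : ∀ s ∈ Icc y Y, HasDerivAt B (C * s ^ (h - 1)) s := by
    intro s hs
    have hs0 : s ≠ 0 := (hy.trans_le hs.1).ne'
    have h1 := (Real.hasDerivAt_rpow_const (p := h) (Or.inl hs0)).sub_const (y ^ h)
    have h2 := (h1.const_mul C).div_const h
    have hh0' : h ≠ 0 := hh0.ne'
    have h3 : C * (h * s ^ (h - 1)) / h = C * s ^ (h - 1) := by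
      field_simp
    rw [h3] at h2
    exact h2
  have key := image_norm_le_of_norm_deriv_right_le_deriv_boundary' (f := g)
    (f' := fun s ↦ I • deriv F (γ s)) (a := y) (b := Y)
    (fun s hs ↦ (hgd s hs).continuousAt.continuousWithinAt)
    (fun s hs ↦ (hgd s (Ico_subset_Icc_self hs)).hasDerivWithinAt) (B := B)
    (B' := fun s ↦ C * s ^ (h - 1)) (by simp [hg, hB])
    (fun s hs ↦ (hBd s hs).continuousAt.continuousWithinAt)
    (fun s hs ↦ (hBd s (Ico_subset_Icc_self hs)).hasDerivWithinAt)
    (fun s hs ↦ by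
      rw [norm_smul, Complex.norm_I, one_mul]
      exact hder s (Ico_subset_Icc_self hs))
    (right_mem_Icc.2 hyY)
  simpa [hg, hB, hγ] using key

/-- **Horizontal segments**: if `F` is complex differentiable at the points `r + iY`,
`r ∈ [x₁, x₂]`, with `|F'(r + iY)| ≤ D` there, then `|F(x₂ + iY) - F(x₁ + iY)| ≤ D (x₂ - x₁)`.
[folklore] -/
theorem norm_sub_le_of_horizontal {x₁ x₂ Y D : ℝ} (hx : x₁ ≤ x₂)
    (hdiff : ∀ r ∈ Icc x₁ x₂, DifferentiableAt ℂ F ((r : ℂ) + (Y : ℂ) * I))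
    (hder : ∀ r ∈ Icc x₁ x₂, ‖deriv F ((r : ℂ) + (Y : ℂ) * I)‖ ≤ D) :
    ‖F ((x₂ : ℂ) + (Y : ℂ) * I) - F ((x₁ : ℂ) + (Y : ℂ) * I)‖ ≤ D * (x₂ - x₁) := by
  set γ : ℝ → ℂ := fun r ↦ (r : ℂ) + (Y : ℂ) * I with hγ
  have hγd : ∀ r, HasDerivAt γ 1 r := fun r ↦
    (Complex.ofRealCLM.hasDerivAt).add_const _
  set g : ℝ → ℂ := fun r ↦ F (γ r) with hg
  have hgd : ∀ r ∈ Icc x₁ x₂, HasDerivAt g ((1 : ℂ) • deriv F (γ r)) r := fun r hr ↦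
    (hdiff r hr).hasDerivAt.scomp r (hγd r)
  have key := norm_image_sub_le_of_norm_deriv_le_segment' (f := g)
    (f' := fun r ↦ (1 : ℂ) • deriv F (γ r)) (a := x₁) (b := x₂) (C := D)
    (fun r hr ↦ (hgd r hr).hasDerivWithinAt)
    (fun r hr ↦ by
      rw [one_smul]
      exact hder r (Ico_subset_Icc_self hr))
    x₂ (right_mem_Icc.2 hx)
  simpa [hg, hγ] using key

/-! ### From the derivative growth to Hölder continuity -/

/-- Imaginary parts of the points `r + is` (a private copy of
`Literature.Analysis.Complex.im_ofReal_add_ofReal_mul_I`). [folklore] -/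
private theorem im_ofReal_add_mul_I (r s : ℝ) : ((r : ℂ) + (s : ℂ) * I).im = s := by simp

/-- Real parts of the points `r + is` (private copy). [folklore] -/
private theorem re_ofReal_add_mul_I (r s : ℝ) : ((r : ℂ) + (s : ℂ) * I).re = r := by simp

/-- **Derivative growth to Hölder continuity** ("this implies Hölder continuity with exponent
`h` on `A`"): let `F` be holomorphic on `ℍₒ` with `|F'(w)| ≤ C (im w)^{h-1}` whenever
`0 < im w ≤ 1` and `|re w| ≤ R` (`0 < h ≤ 1`, `C, R ≥ 0`). Then for `z, z'` in the box
`{0 < im ≤ 1/2, |re| ≤ R}`, `|F z - F z'| ≤ (40 C (R + 1)/h) |z - z'|^h`. Close pairs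
(`|z - z'| < 1/8`): along `z ↑ (re z + iY) → (re z' + iY) ↓ z'`, `Y = max(im z, im z', 2|z - z'|)`,
the vertical legs cost `≤ C (Y^h - y^h)/h ≤ C (2|z-z'|)^h/h` each (`Y - y ≤ 2|z - z'|` and
subadditivity of `s ↦ s^h`) and the horizontal one `≤ C Y^{h-1} |z - z'| ≤ C |z - z'|^h`; far
pairs: `|F z - F(i/2)| ≤ C/h + 2CR` by the same legs.
[cite: RohdeSchramm2005, Thm 5.2 (proof, arXiv p. 12)] -/
theorem norm_sub_le_rpow_of_norm_deriv_le (hF : DifferentiableOn ℂ F upperHalfPlaneSet)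
    {h C R : ℝ} (hh0 : 0 < h) (hh1 : h ≤ 1) (hC : 0 ≤ C) (hR : 0 ≤ R)
    (hder : ∀ w : ℂ, 0 < w.im → w.im ≤ 1 → |w.re| ≤ R → ‖deriv F w‖ ≤ C * w.im ^ (h - 1))
    {z z' : ℂ} (hz0 : 0 < z.im) (hz1 : z.im ≤ 1 / 2) (hzR : |z.re| ≤ R)
    (hz'0 : 0 < z'.im) (hz'1 : z'.im ≤ 1 / 2) (hz'R : |z'.re| ≤ R) :
    ‖F z - F z'‖ ≤ 40 * C * (R + 1) / h * ‖z - z'‖ ^ h := by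
  have hdiffAt : ∀ w : ℂ, 0 < w.im → DifferentiableAt ℂ F w := fun w hw ↦
    hF.differentiableAt (isOpen_upperHalfPlaneSet.mem_nhds hw)
  -- the two kinds of legs, inside the box `{0 < im ≤ 1, |re| ≤ R}`
  have vert : ∀ {x y Y : ℝ}, 0 < y → y ≤ Y → Y ≤ 1 → |x| ≤ R →
      ‖F ((x : ℂ) + (Y : ℂ) * I) - F ((x : ℂ) + (y : ℂ) * I)‖ ≤ C * (Y ^ h - y ^ h) / h := by
    intro x y Y hy hyY hY1 hx
    refine norm_sub_le_of_vertical hh0 hy hyY (fun s hs ↦ hdiffAt _ ?_) fun s hs ↦ ?_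
    · rw [im_ofReal_add_mul_I]
      exact hy.trans_le hs.1
    · have := hder ((x : ℂ) + (s : ℂ) * I) (by rw [im_ofReal_add_mul_I]; exact hy.trans_le hs.1)
        (by rw [im_ofReal_add_mul_I]; exact hs.2.trans hY1) (by rwa [re_ofReal_add_mul_I])
      rwa [im_ofReal_add_mul_I] at this
  have horiz : ∀ {x₁ x₂ Y : ℝ}, x₁ ≤ x₂ → 0 < Y → Y ≤ 1 → |x₁| ≤ R → |x₂| ≤ R →
      ‖F ((x₂ : ℂ) + (Y : ℂ) * I) - F ((x₁ : ℂ) + (Y : ℂ) * I)‖ ≤ C * Y ^ (h - 1) * (x₂ - x₁) := by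
    intro x₁ x₂ Y hx hY0 hY1 hx₁ hx₂
    have hrR : ∀ r ∈ Icc x₁ x₂, |r| ≤ R := fun r hr ↦
      abs_le.2 ⟨by linarith [(abs_le.1 hx₁).1, hr.1], by linarith [(abs_le.1 hx₂).2, hr.2]⟩
    refine norm_sub_le_of_horizontal hx (fun r _ ↦ hdiffAt _ ?_) fun r hr ↦ ?_
    · rwa [im_ofReal_add_mul_I]
    · have := hder ((r : ℂ) + (Y : ℂ) * I) (by rwa [im_ofReal_add_mul_I])
        (by rwa [im_ofReal_add_mul_I]) (by rw [re_ofReal_add_mul_I]; exact hrR r hr)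
      rwa [im_ofReal_add_mul_I] at this
  -- symmetric horizontal bound
  have horiz' : ∀ {x₁ x₂ Y : ℝ}, 0 < Y → Y ≤ 1 → |x₁| ≤ R → |x₂| ≤ R →
      ‖F ((x₂ : ℂ) + (Y : ℂ) * I) - F ((x₁ : ℂ) + (Y : ℂ) * I)‖ ≤ C * Y ^ (h - 1) * |x₂ - x₁| := by
    intro x₁ x₂ Y hY0 hY1 hx₁ hx₂
    rcases le_total x₁ x₂ with hx | hx
    · rw [abs_of_nonneg (sub_nonneg.2 hx)]
      exact horiz hx hY0 hY1 hx₁ hx₂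
    · rw [norm_sub_rev, abs_sub_comm, abs_of_nonneg (sub_nonneg.2 hx)]
      exact horiz hx hY0 hY1 hx₂ hx₁
  -- coordinates
  set x := z.re with hx
  set y := z.im with hy
  set x' := z'.re with hx'
  set y' := z'.im with hy'
  have hzxy : z = (x : ℂ) + (y : ℂ) * I := (re_add_im z).symm
  have hz'xy : z' = (x' : ℂ) + (y' : ℂ) * I := (re_add_im z').symm
  set d := ‖z - z'‖ with hd
  have hd0 : 0 ≤ d := norm_nonneg _
  have hdx : |x - x'| ≤ d := by rw [hx, hx', ← sub_re]; exact abs_re_le_norm _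
  have hdy : |y - y'| ≤ d := by rw [hy, hy', ← sub_im]; exact abs_im_le_norm _
  have hK0 : 0 ≤ 40 * C * (R + 1) / h := by positivity
  have hCh : C ≤ C / h := by
    rw [le_div_iff₀ hh0]
    exact mul_le_of_le_one_right hC hh1
  by_cases hfar : 1 / 8 ≤ d
  · -- far pairs: both values are within `C/h + 2CR` of `F(i/2)`
    have hhalf : ∀ {u v : ℝ}, 0 < v → v ≤ 1 / 2 → |u| ≤ R →
        ‖F ((u : ℂ) + (v : ℂ) * I) - F ((0 : ℝ) + ((1 / 2 : ℝ) : ℂ) * I)‖ ≤ C / h + 2 * C * R := by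
      intro u v hv0 hv1 hu
      have h1 := vert hv0 hv1 (by norm_num) hu
      have h2 := horiz' (x₁ := 0) (x₂ := u) (Y := 1 / 2) (by norm_num) (by norm_num)
        (by simp [hR]) hu
      have h3 : C * ((1 / 2 : ℝ) ^ h - v ^ h) / h ≤ C / h := by
        rw [div_le_div_iff_of_pos_right hh0]
        have h4 : (1 / 2 : ℝ) ^ h ≤ 1 := Real.rpow_le_one (by norm_num) (by norm_num) hh0.le
        have h5 : 0 ≤ v ^ h := Real.rpow_nonneg hv0.le h
        nlinarith
      have h6 : C * (1 / 2 : ℝ) ^ (h - 1) * |u - 0| ≤ 2 * C * R := by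
        rw [sub_zero]
        have h7 : (1 / 2 : ℝ) ^ (h - 1) ≤ 2 := by
          rw [one_div, Real.inv_rpow zero_le_two, ← Real.rpow_neg zero_le_two, neg_sub]
          calc (2 : ℝ) ^ (1 - h) ≤ 2 ^ (1 : ℝ) :=
                Real.rpow_le_rpow_of_exponent_le one_le_two (by linarith)
            _ = 2 := Real.rpow_one 2
        calc C * (1 / 2 : ℝ) ^ (h - 1) * |u| ≤ C * 2 * R := by
              apply mul_le_mul (mul_le_mul_of_nonneg_left h7 hC) hu (abs_nonneg _) (by positivity)
          _ = 2 * C * R := by ring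
      calc ‖F ((u : ℂ) + (v : ℂ) * I) - F ((0 : ℝ) + ((1 / 2 : ℝ) : ℂ) * I)‖
          ≤ ‖F ((u : ℂ) + (v : ℂ) * I) - F ((u : ℂ) + ((1 / 2 : ℝ) : ℂ) * I)‖ +
            ‖F ((u : ℂ) + ((1 / 2 : ℝ) : ℂ) * I) - F ((0 : ℝ) + ((1 / 2 : ℝ) : ℂ) * I)‖ :=
            norm_sub_le_norm_sub_add_norm_sub _ _ _
        _ ≤ C / h + 2 * C * R := by
            rw [norm_sub_rev] at h1
            linarith
    have h1 := hhalf hz0 hz1 hzR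
    have h2 := hhalf hz'0 hz'1 hz'R
    rw [← hzxy] at h1
    rw [← hz'xy] at h2
    have h3 : ‖F z - F z'‖ ≤ 2 * (C / h + 2 * C * R) := by
      have := norm_sub_le_norm_sub_add_norm_sub (F z) (F ((0 : ℝ) + ((1 / 2 : ℝ) : ℂ) * I)) (F z')
      rw [norm_sub_rev (F ((0 : ℝ) + ((1 / 2 : ℝ) : ℂ) * I))] at this
      linarith
    have h4 : 1 ≤ 8 * d ^ h := by
      have h5 : 1 ≤ (8 * d) ^ h := Real.one_le_rpow (by linarith) hh0.le
      have h6 : (8 * d) ^ h = 8 ^ h * d ^ h := Real.mul_rpow (by norm_num) hd0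
      have h7 : (8 : ℝ) ^ h ≤ 8 := Real.rpow_le_self_of_one_le (by norm_num) hh1
      have h8 : 0 ≤ d ^ h := Real.rpow_nonneg hd0 h
      nlinarith
    have h5 : 2 * (C / h + 2 * C * R) * 8 ≤ 40 * C * (R + 1) / h := by
      have hA : C * R ≤ C / h * R := mul_le_mul_of_nonneg_right hCh hR
      have hB : 0 ≤ C / h * R := by positivity
      have hC' : 0 ≤ C / h := by positivity
      have h7 : 40 * C * (R + 1) / h = 40 * (C / h * R) + 40 * (C / h) := by ring
      rw [h7]
      nlinarith
    calc ‖F z - F z'‖ ≤ 2 * (C / h + 2 * C * R) := h3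
      _ ≤ 2 * (C / h + 2 * C * R) * (8 * d ^ h) :=
          le_mul_of_one_le_right (by positivity) h4
      _ = 2 * (C / h + 2 * C * R) * 8 * d ^ h := by ring
      _ ≤ 40 * C * (R + 1) / h * d ^ h :=
          mul_le_mul_of_nonneg_right h5 (Real.rpow_nonneg hd0 h)
  · -- close pairs
    rw [not_le] at hfar
    rcases hd0.eq_or_lt with hd00 | hdpos
    · have : z = z' := by
        rw [← sub_eq_zero, ← norm_eq_zero]
        exact hd00.symm
      rw [this, sub_self, norm_zero]
      positivity
    set Y : ℝ := max (max y y') (2 * d) with hY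
    have hY2d : 2 * d ≤ Y := le_max_right _ _
    have hyY : y ≤ Y := (le_max_left _ _).trans (le_max_left _ _)
    have hy'Y : y' ≤ Y := (le_max_right _ _).trans (le_max_left _ _)
    have hY0 : 0 < Y := hz0.trans_le hyY
    have hY1 : Y ≤ 1 := by
      rw [hY]
      refine max_le (max_le ?_ ?_) ?_ <;> linarith
    have hYy : Y - y ≤ 2 * d := by
      rw [hY]
      rcases le_total (max y y') (2 * d) with hm | hm
      · rw [max_eq_right hm]
        linarith [hz0]
      · rw [max_eq_left hm]
        rcases le_total y y' with hm' | hm'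
        · rw [max_eq_right hm']
          linarith [(abs_le.1 hdy).1]
        · rw [max_eq_left hm']
          linarith
    have hYy' : Y - y' ≤ 2 * d := by
      rw [hY]
      rcases le_total (max y y') (2 * d) with hm | hm
      · rw [max_eq_right hm]
        linarith [hz'0]
      · rw [max_eq_left hm]
        rcases le_total y y' with hm' | hm'
        · rw [max_eq_right hm']
          linarith
        · rw [max_eq_left hm']
          linarith [(abs_le.1 hdy).2]
    -- subadditivity: `Y^h - v^h ≤ (Y - v)^h ≤ (2d)^h ≤ 2 d^h`
    have h2d : (2 * d) ^ h ≤ 2 * d ^ h := by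
      rw [Real.mul_rpow zero_le_two hd0]
      exact mul_le_mul_of_nonneg_right (Real.rpow_le_self_of_one_le one_le_two hh1)
        (Real.rpow_nonneg hd0 h)
    have hsub : ∀ {v : ℝ}, 0 < v → v ≤ Y → Y - v ≤ 2 * d → Y ^ h - v ^ h ≤ 2 * d ^ h := by
      intro v hv0 hvY hvd
      have h1 : Y ^ h ≤ v ^ h + (Y - v) ^ h := by
        have := Real.rpow_add_le_add_rpow hv0.le (sub_nonneg.2 hvY) hh0.le hh1
        rwa [add_sub_cancel] at this
      have h2 : (Y - v) ^ h ≤ (2 * d) ^ h := Real.rpow_le_rpow (sub_nonneg.2 hvY) hvd hh0.le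
      linarith
    -- the three legs
    have leg1 : ‖F ((x : ℂ) + (Y : ℂ) * I) - F ((x : ℂ) + (y : ℂ) * I)‖ ≤ 2 * C / h * d ^ h := by
      refine (vert hz0 hyY hY1 hzR).trans ?_
      rw [div_mul_eq_mul_div, div_le_div_iff_of_pos_right hh0]
      have := mul_le_mul_of_nonneg_left (hsub hz0 hyY hYy) hC
      linarith
    have leg3 : ‖F ((x' : ℂ) + (Y : ℂ) * I) - F ((x' : ℂ) + (y' : ℂ) * I)‖ ≤
        2 * C / h * d ^ h := by
      refine (vert hz'0 hy'Y hY1 hz'R).trans ?_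
      rw [div_mul_eq_mul_div, div_le_div_iff_of_pos_right hh0]
      have := mul_le_mul_of_nonneg_left (hsub hz'0 hy'Y hYy') hC
      linarith
    have leg2 : ‖F ((x' : ℂ) + (Y : ℂ) * I) - F ((x : ℂ) + (Y : ℂ) * I)‖ ≤ C * d ^ h := by
      refine (horiz' hY0 hY1 hzR hz'R).trans ?_
      have h1 : Y ^ (h - 1) ≤ d ^ (h - 1) :=
        Real.rpow_le_rpow_of_nonpos hdpos (by linarith) (by linarith)
      have h2 : |x' - x| ≤ d := by rwa [abs_sub_comm]
      have h3 : d ^ (h - 1) * d = d ^ h := by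
        rw [Real.rpow_sub_one hdpos.ne', div_mul_cancel₀ _ hdpos.ne']
      calc C * Y ^ (h - 1) * |x' - x| ≤ C * d ^ (h - 1) * d := by
            apply mul_le_mul (mul_le_mul_of_nonneg_left h1 hC) h2 (abs_nonneg _)
            exact mul_nonneg hC (Real.rpow_nonneg hd0 _)
        _ = C * d ^ h := by rw [mul_assoc, h3]
    have htotal : ‖F z - F z'‖ ≤ (2 * C / h + C + 2 * C / h) * d ^ h := by
      rw [hzxy, hz'xy]
      calc ‖F ((x : ℂ) + (y : ℂ) * I) - F ((x' : ℂ) + (y' : ℂ) * I)‖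
          ≤ ‖F ((x : ℂ) + (y : ℂ) * I) - F ((x : ℂ) + (Y : ℂ) * I)‖ +
            ‖F ((x : ℂ) + (Y : ℂ) * I) - F ((x' : ℂ) + (Y : ℂ) * I)‖ +
            ‖F ((x' : ℂ) + (Y : ℂ) * I) - F ((x' : ℂ) + (y' : ℂ) * I)‖ := by
            have h1 := norm_sub_le_norm_sub_add_norm_sub (F ((x : ℂ) + (y : ℂ) * I))
              (F ((x : ℂ) + (Y : ℂ) * I)) (F ((x' : ℂ) + (y' : ℂ) * I))
            have h2 := norm_sub_le_norm_sub_add_norm_sub (F ((x : ℂ) + (Y : ℂ) * I))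
              (F ((x' : ℂ) + (Y : ℂ) * I)) (F ((x' : ℂ) + (y' : ℂ) * I))
            linarith
        _ ≤ 2 * C / h * d ^ h + C * d ^ h + 2 * C / h * d ^ h := by
            rw [norm_sub_rev] at leg1 leg2
            linarith
        _ = (2 * C / h + C + 2 * C / h) * d ^ h := by ring
    refine htotal.trans (mul_le_mul_of_nonneg_right ?_ (Real.rpow_nonneg hd0 h))
    rw [show 2 * C / h + C + 2 * C / h = (4 * C + C * h) / h by field_simp; ring,
      div_le_div_iff_of_pos_right hh0]
    nlinarith [mul_le_of_le_one_right hC hh1]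

end RohdeSchramm

end Literature.Probability.RandomPlanarGeometry
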